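import Mathlib

/-!
# Solo-blind kernel #105 — the low-branch similarity class admits no quartic (neutral-leaf) landing

Steady-door programme (solo-blind), paper §24.22 / §24.57.  In the similarity class of the outer
free-boundary problem of the low branch the reduced pattern intensity `Q` obeys `Q''' = X^2 - 1`
with a cubic lift-off `Q = Q' = Q'' = 0` at the upstream contact `X₀`; it then lands with a
*double* zero (`Q = Q' = 0`, `Q'' ≠ 0`) at `X_R = √6`, and the non-zero `Q''` is the velocity
jump `[u]` whose viscous smoothing produces the shear spike `μ_max ∝ n^{2/3}` (§24.22(4)) — the
source of every flank pathology of §§24.27–24.56.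

A landing of one order higher at the downstream *neutral leaf* `X = 1` (where `Q''' = 0`
automatically), i.e. `Q(1) = Q'(1) = Q''(1) = 0`, would have no velocity jump.  Writing
`Q(X) = ∫_{X₀}^{X} (X-t)^2/2 · (t^2-1) dt`, the three conditions are the moments
`M_k(X₀) := ∫_{X₀}^{1} (1-t)^k (t^2 - 1) dt = 0`, `k = 0, 1, 2`.  In closed form
`M_0(X₀) = -2/3 - X₀^3/3 + X₀` and `M_1(X₀) = -5/12 - (X₀^3/3 - X₀ - X₀^4/4 + X₀^2/2)`.

We prove: `-3·M_0 = (X₀-1)^2 (X₀+2)`, so `M_0 = 0` forces `X₀ ∈ {1, -2}`; `M_1(-2) = 27/12 ≠ 0`;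
hence **no lift-off point `X₀ ≠ 1` satisfies even the first two landing conditions**
(`no_quartic_landing`).  We also identify `M_0`, `M_1` with the interval integrals.
Consequence used in §24.57: a quartic landing needs a reduced growth profile with at least three
sign changes on the live interval (two humps, or a saturated core) — never the one-hump
similarity class — which is why the neutral-leaf redesign uses a dimpled ridge and the two
running dials `(ν_j, U_j)`.
-/

namespace Summit.AnomalousDissipation.AnomalousDissipation.Theorems

open intervalIntegral

/-- `k = 0` landing moment of the similarity class, as a function of the lift-off point `X₀`. -/
noncomputable def landingMoment0 (X₀ : ℝ) : ℝ := -(2/3) - X₀ ^ 3 / 3 + X₀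

/-- `k = 1` landing moment of the similarity class. -/
noncomputable def landingMoment1 (X₀ : ℝ) : ℝ :=
  -(5/12) - (X₀ ^ 3 / 3 - X₀ - X₀ ^ 4 / 4 + X₀ ^ 2 / 2)

/-- The zeroth moment factors: `-3 M₀(X₀) = (X₀ - 1)² (X₀ + 2)`. -/
theorem landingMoment0_factor (X₀ : ℝ) :
    -3 * landingMoment0 X₀ = (X₀ - 1) ^ 2 * (X₀ + 2) := by
  unfold landingMoment0; ring

/-- `M₀(X₀) = 0` iff the lift-off point is `1` (empty live interval) or `-2`. -/
theorem landingMoment0_eq_zero_iff (X₀ : ℝ) :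
    landingMoment0 X₀ = 0 ↔ X₀ = 1 ∨ X₀ = -2 := by
  constructor
  · intro h
    have hf := landingMoment0_factor X₀
    rw [h, mul_zero] at hf
    have hf' : (X₀ - 1) ^ 2 * (X₀ + 2) = 0 := hf.symm
    rcases mul_eq_zero.mp hf' with h1 | h2
    · left; have := pow_eq_zero_iff (n := 2) (by norm_num) |>.mp h1; linarith
    · right; linarith
  · rintro (rfl | rfl) <;> unfold landingMoment0 <;> norm_num

/-- At the only admissible lift-off point `X₀ = -2` the first moment is `27/12`. -/
theorem landingMoment1_neg_two : landingMoment1 (-2) = 27 / 12 := by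
  unfold landingMoment1; norm_num

/-- **No quartic (neutral-leaf) landing in the similarity class.**  If the live interval is
non-empty (`X₀ ≠ 1`) and the zeroth landing moment vanishes, the first one does not. -/
theorem no_quartic_landing (X₀ : ℝ) (hX : X₀ ≠ 1) (h0 : landingMoment0 X₀ = 0) :
    landingMoment1 X₀ ≠ 0 := by
  rcases (landingMoment0_eq_zero_iff X₀).mp h0 with h | h
  · exact absurd h hX
  · subst h; rw [landingMoment1_neg_two]; norm_num

/-- Equivalently: the two conditions `M₀ = M₁ = 0` force the degenerate case `X₀ = 1`. -/
theorem quartic_landing_conditions_force_empty (X₀ : ℝ)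
    (h0 : landingMoment0 X₀ = 0) (h1 : landingMoment1 X₀ = 0) : X₀ = 1 := by
  by_contra hX
  exact no_quartic_landing X₀ hX h0 h1

/-- `M₀` is the interval integral `∫_{X₀}^{1} (t² - 1) dt`. -/
theorem landingMoment0_eq_integral (X₀ : ℝ) :
    ∫ t in X₀..1, (t ^ 2 - 1) = landingMoment0 X₀ := by
  rw [integral_sub (by apply Continuous.intervalIntegrable; fun_prop) (by apply Continuous.intervalIntegrable; fun_prop), integral_pow, integral_one]
  unfold landingMoment0; ring

/-- `M₁` is the interval integral `∫_{X₀}^{1} (1 - t)(t² - 1) dt`. -/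
theorem landingMoment1_eq_integral (X₀ : ℝ) :
    ∫ t in X₀..1, (1 - t) * (t ^ 2 - 1) = landingMoment1 X₀ := by
  have h : ∀ t : ℝ, (1 - t) * (t ^ 2 - 1) = t ^ 2 - 1 - t ^ 3 + t := fun t => by ring
  simp_rw [h]
  rw [integral_add (by apply Continuous.intervalIntegrable; fun_prop) (by apply Continuous.intervalIntegrable; fun_prop), integral_sub (by apply Continuous.intervalIntegrable; fun_prop) (by apply Continuous.intervalIntegrable; fun_prop),
    integral_sub (by apply Continuous.intervalIntegrable; fun_prop) (by apply Continuous.intervalIntegrable; fun_prop), integral_pow, integral_pow, integral_one,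
    integral_id]
  unfold landingMoment1; ring

end Summit.AnomalousDissipation.AnomalousDissipation.Theorems
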